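import Literature.MathematicalPhysics.QuantumFieldTheory.Balaban1983to89.B11Eq98CurrentSlot

/-!
# `Balaban1983to89.B11Eq28JcurWindow` — T. Bałaban, *The variational problem and background fields in renormalization group method for lattice gauge
theories*, Commun. Math. Phys. **102** (1985) 277–309 [Balaban1985Variational], (27)–(28) p. 282 («|J| < C₁B₃ε₁(Lʲη)⁻³»), with [Balaban1985BackgroundPropagators]
(3.36) p. 396 (the current window of the small-field class): **THE LETTER `‖J‖₍₋₃₎` OF THE W-SLOT FROM PRINT's CURRENT WINDOW AND THE WEIGHT PROFILE** —
`‖Jcur U₀‖₍₋₃₎ ≤ ω₃·j₀` whenever `‖J_μ(y)‖ ≤ j₀` bondwise (the chart's class hypothesis, `B9Eq39Adjoint.J` at the shift transporters) and the `|·|_{(−3)}`-weights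
are `≤ ω₃`: the letter `M_J` of this seat's `B11Ineq98W80LatticeFree.exists_quadAnalytic_W80_latticeFree` ∕ `Support/NE9CurChartTowerPiLatticeUniformW80`,
lattice-free through the weight-profile letter (one `NegSup.norm_le_iff`; kept in its own file — inside the 50-binder files the statement does not elaborate
within the default heartbeats)

statement-level skeleton of published theorems with citation tags; proofs where landed; nothing here is a claim about the Yang–Mills mass gap

Filed by the NE9 crux-team leaf seat `b2b-balaban-t4-ne9-formalise-leaf-01` (gen 97); NEW file; imports `B11Eq98CurrentSlot` ONLY; nothing modified; 0 def.
HONEST: bookkeeping; NOT summit progress (cell pub-balaban: NE9 NOT PRINTED ∕ NOT PROVED; spine PROVED 0∕9; NOT infinite volume, NOT mass gap, NOT Clay).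
-/

noncomputable section

namespace Literature.MathematicalPhysics.QuantumFieldTheory.Balaban1983to89.B11Eq28JcurWindow

open B9SectCLatticeCarrier (Bond)
open B11Eq115Space

variable {𝔸 : Type*} [NormedRing 𝔸] [NormedAlgebra ℂ 𝔸] {d : ℕ}

/-- **`‖J‖₍₋₃₎ ≤ ω₃·j₀` FROM THE CURRENT WINDOW**: the carrier current `Jcur U₀` ((27)/(28) read in `|·|_{(−3)}`, `B11Eq98CurrentSlot.Jcur`) is bounded by the bondwise
window `‖J_μ(y)‖ ≤ j₀` times any bound `ω₃` of the weights `(L^{j(b)}η)³`. [cite: Balaban1985Variational, (28) p.282; Balaban1985BackgroundPropagators, (3.36) p.396] -/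
theorem norm_Jcur_le_of_window (L : ℝ) {Pd : Fin d → ℕ} {η : ℝ} [Fact (0 < L)] [Fact (0 < η)] {lev₀ : Bond d Pd → ℕ} (U₀ : Bond d Pd → 𝔸ˣ)
    {j₀ ω₃ : ℝ} (hj₀ : 0 ≤ j₀) (hω₃ : 0 ≤ ω₃) (hw : ∀ b, levWeight L η lev₀ 3 b ≤ ω₃)
    (hJ : ∀ μ y, ‖B9Eq39Adjoint.J (fun μ => B9Eq33CovDerivVector.shiftEquiv μ) (fun μ y => U₀ (y, μ)) η μ y‖ ≤ j₀) :
    ‖B11Eq98CurrentSlot.Jcur (L := L) (η := η) (lev₀ := lev₀) U₀‖ ≤ ω₃ * j₀ := by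
  rw [NegSup.norm_le_iff (by positivity)]
  intro b
  have e : NegSup.equiv (levWeight L η lev₀ 3) 𝔸 (B11Eq98CurrentSlot.Jcur (L := L) (η := η) (lev₀ := lev₀) U₀) b =
      B9Eq39Adjoint.J (fun μ => B9Eq33CovDerivVector.shiftEquiv μ) (fun μ y => U₀ (y, μ)) η b.2 b.1 := rfl
  rw [e]
  exact mul_le_mul (hw b) (hJ b.2 b.1) (norm_nonneg _) hω₃

/-- The weights `(L^{j(b)}η)³` are `≤ ω³` when the weights `L^{j(b)}η` are `≤ ω` (the weight-profile letter `w̄₀ ≤ ω` of the chart). [cite: Balaban1985Variational, p.286] -/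
theorem levWeight_three_le (L : ℝ) {Pd : Fin d → ℕ} {η : ℝ} [Fact (0 < L)] [Fact (0 < η)] {lev₀ : Bond d Pd → ℕ} {ω : ℝ}
    (hw : ∀ b, levWeight L η lev₀ 1 b ≤ ω) (b : Bond d Pd) : levWeight L η lev₀ 3 b ≤ ω ^ 3 := by
  have h0 : 0 ≤ levWeight L η lev₀ 1 b := (levWeight_pos (Fact.out : 0 < L) (Fact.out : 0 < η) lev₀ 1 b).le
  have h1 := hw b
  rw [levWeight_apply] at h0 h1 ⊢
  rw [pow_one] at h0 h1
  exact pow_le_pow_left₀ h0 h1 3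

end Literature.MathematicalPhysics.QuantumFieldTheory.Balaban1983to89.B11Eq28JcurWindow

end
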